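import Summits.QuantumFields.YangMills.Theorems.UnitScaleTiltProp7FramedHessianCell
import HarnessLib

/-!
# Route `UnitScaleTilt`, crux K1 «MinimiserStabilityRegPr» (stmt-QuantumFields-19200), route-R E′ path (α′), S2 = P-cov2 (the COVARIANT (hK)), brick (D1-cov) FILE B2 —
# ★★★ THE CENTRE-PINNED `H²` POINCARÉ INEQUALITY FOR THE COVARIANT LAPLACIAN ON THE TORUS (d = 3):
# `Σ_x hs(e x) ≤ κ₁·ℓ⁴·[Σ_x hs(Δ_U e x) + (2da + 8dτ₁²)·Σ_xΣ_μ hs(D_μe x) + d²(4Na² + (2τ₂+4τ₁²)²)·Σ_x hs(e x)]` for `e` vanishing on the `k`-centres, and its absorbed form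

Cell `ym3-torus`, extra width seat `ym-routeR-w6` (gen 6); LOCATE `ym-routeR-w6/LOCATE-PCOV2-routeRw6g6.md` (19200 evidence #42) §2 STEPS 3–5.  THEOREMS ONLY (0 `def`, 0 `sorry`);
`--supports stmt-QuantumFields-19200`, count-neutral.  YM₃ on T³ is a ladder rung (R3), not the Clay problem; nothing here claims a stub, the crux, d = 4 or the mass gap.

THE POINT.  The flat (D1-glob) ✓ `Prop7CentrePinnedHessianPoincare.sum_sq_le_laplace_sq_of_vanish_centres` is the coercivity input that the flat (hK) chain consumes three times (global gap,
Agmon window, local sup conversion).  Its covariant twin is the first brick of P-cov2 = the supplier of P-cov1 ✓ `Prop7CentreHarmonicRegaugeSupCov.sup_regaugeCov_le_of_rows`'s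
displayed rows `hInterp`∕`hInterp₀` at the curved background.  Architecture (all inputs in the tree BY NAME): STEP A ✓ `sum_sq_le_sum_cells` per real component; per cell the covariant
cell inequality ✓ `Prop7FramedHessianCell.sum_cell_hs_le_framed` in that cell's frame (its right side is frame-free); STEP D ✓ `sum_boxes_le` (`13³`) on the resulting site function;
the shifted first-order and zeroth-order sums are torus sums (✓ `sum_shift`); the covariant Bochner step is ✓ `Prop7CovariantCoercivity.sum_covD_sq_le_curl_sq_add_divB_sq` at
`A := D_Ue` with ✓ `Prop7CovariantCurlOfGrad.norm_curl_covD_le` (`curl D_Ue = [plaquette, e]`).  At the member (`a = e_aℓ⁻²`, `τ₁ = C₀e∕ℓ`, `τ₂ = C₁e∕ℓ²`) every `ℓ` cancels exactly as in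
the flat count and the absorbed form reads `Σ hs(e) ≤ C′_G·ℓ⁴·Σ hs(Δ_Ue)`.

WHAT IS PROVED (ns `…Theorems.Prop7CentrePinnedHessianPoincareCov`; `T = torusT P 0`, unitary `U : Fin P.d → Site P 0 → (M_N ℂ)ˣ`, `hs X = Σ_{jk}‖X_jk‖²`, `ℓ = L^k`).
* §1 bookkeeping: `sum_ab_comm₄`, `sum_hs_eq_components`, `sum_shift₂_inner`∕`sum_shift₂_outer`∕`sum_shift_shift` (shifted triple sums are `d`∕`d²` times torus sums),
  `hs_curl_covD_le` (`hs([D_μ,D_ν]e(x)) ≤ 4Na²·hs(e(T_μT_νx))`), `two_mul_dirichlet_le` (`2·Σ_xΣ_μhs(D_μe) ≤ s·Σhs(e) + s⁻¹·Σhs(Δ_Ue)`, re-trace adjointness + AM–GM).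
* §2 ★★★ `sum_hs_le_rows` — the displayed-rows form above (frames per corner-cell with the rows of FILE B1 on the `13³`-cell Hessian window).
* §3 ★★★ `sum_hs_le_covLaplace_hs` — ABSORBED: if `κ₁ℓ⁴·d²(4Na² + (2τ₂+4τ₁²)²) ≤ 1∕4` then `Σ_x hs(e x) ≤ 2(κ₁ℓ⁴ + (κ₁ℓ⁴(2da + 8dτ₁²))²)·Σ_x hs(Δ_Ue x)`
  (`κ₁ = 4·13³·N²·C_M`, `C_M = 24·289·24576·46116`).
HONEST SCOPE.  The frames and their four rows per cell stay DISPLAYED (member: [Balaban1985BackgroundPropagators] (3.35) cube gauges around the centres, ✓ `Prop7ConjFrameReg335`,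
✓ `Prop7LemmaHCurvedFramesOfReg335` pattern, with the transverse link differences its source `Reg335Cube` carries); constants ours, far from sharp; level-`0` torus with
`C = range (embIter k)` only.  Not (D2′-cov), not (N-cov), not (A-cov).

References: M. Giaquinta, *Multiple integrals…*, Princeton 1983 [Giaquinta1984] (Ch. III §1 Thm 1.2 pp.70–72); T. Bałaban, CMP 99 (1985) 389–434 [Balaban1985BackgroundPropagators]
((3.8)–(3.10) p.392, (3.28) p.395, (3.35) p.396); CMP 102 (1985) 277–309 [Balaban1985Variational] ((135) p.298, Prop. 7 p.299).
-/

set_option autoImplicit false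

noncomputable section

open scoped BigOperators Matrix.Norms.L2Operator Matrix

namespace Summit.QuantumFields.YangMills.Theorems.Prop7CentrePinnedHessianPoincareCov

open Literature.MathematicalPhysics.QuantumFieldTheory.Balaban1983to89
open LatticeFieldCalculus
open B4Eq19LatticeOperators (Zd box)
open B9Eq39Adjoint (R covD curl divB plaqU sum_sum_covD_mul)
open B9TorusCalculus (torusT torusT_apply torusT_comm)
open B15DeterminingSets (embIter)
open Summit.QuantumFields.YangMills.Theorems.Prop7FlatCoercivity (sum_shift)
open Summit.QuantumFields.YangMills.Theorems.Prop7TorusHessianLift (cast_mem_range_embIter)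
open Summit.QuantumFields.YangMills.Theorems.Prop7CentrePinnedHessianPoincare (sum_sq_le_sum_cells sum_boxes_le)
open Summit.QuantumFields.YangMills.Theorems.Prop7CovariantCoercivity (sum_norm_sq_le_mul_opNorm_sq mem_U1_of_unitary conjTranspose_covD
  re_trace_conjTranspose_mul_self two_mul_abs_re_trace_le re_trace_mul_comm sum_covD_sq_le_curl_sq_add_divB_sq)
open Summit.QuantumFields.YangMills.Theorems.Prop7CovariantCurlOfGrad (norm_curl_covD_le)
open Summit.QuantumFields.YangMills.Theorems.Prop7FramedHessianCell (sum_cell_hs_le_framed)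

variable {P : Params} {N : ℕ} [NeZero N]

/-! ## §1 Bookkeeping: components, shifted sums, the curl of a gradient, the Dirichlet form -/

/-- `Σ_a Σ_b Σ_{t∈T} Σ_{z∈Z t} g = Σ_{t∈T} Σ_{z∈Z t} Σ_a Σ_b g`. [folklore] -/
theorem sum_ab_comm₄ {α β γ δ : Type*} [Fintype α] [Fintype β] (Tt : Finset γ) (Z : γ → Finset δ) (g : α → β → γ → δ → ℝ) :
    ∑ a, ∑ b, ∑ t ∈ Tt, ∑ z ∈ Z t, g a b t z = ∑ t ∈ Tt, ∑ z ∈ Z t, ∑ a, ∑ b, g a b t z := by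
  calc ∑ a, ∑ b, ∑ t ∈ Tt, ∑ z ∈ Z t, g a b t z = ∑ a, ∑ t ∈ Tt, ∑ b, ∑ z ∈ Z t, g a b t z :=
        Finset.sum_congr rfl fun a _ => Finset.sum_comm
    _ = ∑ t ∈ Tt, ∑ a, ∑ b, ∑ z ∈ Z t, g a b t z := Finset.sum_comm
    _ = ∑ t ∈ Tt, ∑ z ∈ Z t, ∑ a, ∑ b, g a b t z := Finset.sum_congr rfl fun t _ => by
        calc ∑ a, ∑ b, ∑ z ∈ Z t, g a b t z = ∑ a, ∑ z ∈ Z t, ∑ b, g a b t z := Finset.sum_congr rfl fun a _ => Finset.sum_comm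
          _ = ∑ z ∈ Z t, ∑ a, ∑ b, g a b t z := Finset.sum_comm

omit [NeZero N] in
/-- the Hilbert–Schmidt mass in real components: `Σ_x hs(e x) = Σ_a Σ_b (Σ_x (Re e_ab)² + Σ_x (Im e_ab)²)`. [folklore] -/
theorem sum_hs_eq_components (e : Site P 0 → Matrix (Fin N) (Fin N) ℂ) :
    ∑ x : Site P 0, ∑ a : Fin N, ∑ b : Fin N, ‖(e x) a b‖ ^ 2
      = ∑ a : Fin N, ∑ b : Fin N, (∑ x : Site P 0, ((e x) a b).re ^ 2 + ∑ x : Site P 0, ((e x) a b).im ^ 2) := by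
  rw [Finset.sum_comm]
  refine Finset.sum_congr rfl fun a _ => ?_
  rw [Finset.sum_comm]
  refine Finset.sum_congr rfl fun b _ => ?_
  rw [← Finset.sum_add_distrib]
  exact Finset.sum_congr rfl fun x _ => by rw [Complex.sq_norm, Complex.normSq_apply]; ring

/-- `Σ_x Σ_μ Σ_ν F_μ(x + e_ν) = d·Σ_x Σ_μ F_μ(x)`. [folklore] -/
theorem sum_shift₂_inner (F : Fin P.d → Site P 0 → ℝ) :
    ∑ x : Site P 0, ∑ μ : Fin P.d, ∑ ν : Fin P.d, F μ (torusT P 0 ν x) = P.d * ∑ x : Site P 0, ∑ μ : Fin P.d, F μ x := by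
  calc ∑ x : Site P 0, ∑ μ : Fin P.d, ∑ ν : Fin P.d, F μ (torusT P 0 ν x)
      = ∑ x : Site P 0, ∑ ν : Fin P.d, ∑ μ : Fin P.d, F μ (torusT P 0 ν x) := Finset.sum_congr rfl fun x _ => Finset.sum_comm
    _ = ∑ ν : Fin P.d, ∑ x : Site P 0, ∑ μ : Fin P.d, F μ (torusT P 0 ν x) := Finset.sum_comm
    _ = ∑ _ν : Fin P.d, ∑ x : Site P 0, ∑ μ : Fin P.d, F μ x :=
        Finset.sum_congr rfl fun ν _ => by simp only [torusT_apply]; exact sum_shift ν (fun x => ∑ μ : Fin P.d, F μ x)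
    _ = P.d * ∑ x : Site P 0, ∑ μ : Fin P.d, F μ x := by rw [Finset.sum_const, Finset.card_univ, Fintype.card_fin, nsmul_eq_mul]

/-- `Σ_x Σ_μ Σ_ν F_ν(x + e_μ) = d·Σ_x Σ_μ F_μ(x)`. [folklore] -/
theorem sum_shift₂_outer (F : Fin P.d → Site P 0 → ℝ) :
    ∑ x : Site P 0, ∑ μ : Fin P.d, ∑ ν : Fin P.d, F ν (torusT P 0 μ x) = P.d * ∑ x : Site P 0, ∑ μ : Fin P.d, F μ x := by
  have h : ∀ x : Site P 0, ∑ μ : Fin P.d, ∑ ν : Fin P.d, F ν (torusT P 0 μ x) = ∑ ν : Fin P.d, ∑ μ : Fin P.d, F ν (torusT P 0 μ x) :=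
    fun x => Finset.sum_comm
  rw [Finset.sum_congr rfl fun x _ => h x]
  exact sum_shift₂_inner F

/-- `Σ_x Σ_μ Σ_ν g(x + e_ν + e_μ) = d²·Σ_x g(x)`. [folklore] -/
theorem sum_shift_shift (g : Site P 0 → ℝ) :
    ∑ x : Site P 0, ∑ μ : Fin P.d, ∑ ν : Fin P.d, g (torusT P 0 μ (torusT P 0 ν x)) = (P.d : ℝ) ^ 2 * ∑ x : Site P 0, g x := by
  calc ∑ x : Site P 0, ∑ μ : Fin P.d, ∑ ν : Fin P.d, g (torusT P 0 μ (torusT P 0 ν x))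
      = ∑ μ : Fin P.d, ∑ ν : Fin P.d, ∑ x : Site P 0, g (torusT P 0 μ (torusT P 0 ν x)) := by
        rw [Finset.sum_comm]; exact Finset.sum_congr rfl fun μ _ => Finset.sum_comm
    _ = ∑ _μ : Fin P.d, ∑ _ν : Fin P.d, ∑ x : Site P 0, g x :=
        Finset.sum_congr rfl fun μ _ => Finset.sum_congr rfl fun ν _ => by
          simp only [torusT_apply]
          rw [sum_shift ν (fun x => g (x.shift μ)), sum_shift μ g]
    _ = (P.d : ℝ) ^ 2 * ∑ x : Site P 0, g x := by
        rw [Finset.sum_const, Finset.card_univ, Fintype.card_fin, Finset.sum_const, Finset.card_univ, Fintype.card_fin, smul_smul, nsmul_eq_mul]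
        push_cast; ring

/-- ★ the curl of a covariant gradient, Hilbert–Schmidt form: `hs((D_UD_Ue)(p_{μν}(x))) ≤ 4Na²·hs(e(x+e_μ+e_ν))` at a unitary background with plaquettes within `a` of `1`.
[cite: Balaban1985BackgroundPropagators, (3.4) p.391; Balaban1985Variational, (135) p.298] -/
theorem hs_curl_covD_le {U : Fin P.d → Site P 0 → (Matrix (Fin N) (Fin N) ℂ)ˣ}
    (hU : ∀ ν x, (U ν x : Matrix (Fin N) (Fin N) ℂ) ∈ unitary (Matrix (Fin N) (Fin N) ℂ))
    {a : ℝ} (hplaq : ∀ (μ ν : Fin P.d) (x : Site P 0), ‖(plaqU (torusT P 0) U μ ν x : Matrix (Fin N) (Fin N) ℂ) - 1‖ ≤ a)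
    (e : Site P 0 → Matrix (Fin N) (Fin N) ℂ) (μ ν : Fin P.d) (x : Site P 0) :
    ∑ j : Fin N, ∑ k : Fin N, ‖(curl (torusT P 0) U (fun κ => covD (torusT P 0) U κ e) μ ν x) j k‖ ^ 2
      ≤ 4 * N * a ^ 2 * ∑ j : Fin N, ∑ k : Fin N, ‖(e (torusT P 0 μ (torusT P 0 ν x))) j k‖ ^ 2 := by
  have hU1 : ∀ κ y, ‖(U κ y : Matrix (Fin N) (Fin N) ℂ)‖ ≤ 1 ∧ ‖(((U κ y)⁻¹ : (Matrix (Fin N) (Fin N) ℂ)ˣ) : Matrix (Fin N) (Fin N) ℂ)‖ ≤ 1 :=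
    fun κ y => mem_U1_of_unitary (hU κ y)
  have ha : 0 ≤ a := (norm_nonneg _).trans (hplaq μ ν x)
  have h1 := norm_curl_covD_le (torusT P 0) U hU1 e μ ν x (torusT_comm ν μ x)
  have h2 : ‖curl (torusT P 0) U (fun κ => covD (torusT P 0) U κ e) μ ν x‖ ≤ 2 * a * ‖e (torusT P 0 μ (torusT P 0 ν x))‖ :=
    h1.trans (by gcongr; exact hplaq μ ν x)
  have h3 := sum_norm_sq_le_mul_opNorm_sq (curl (torusT P 0) U (fun κ => covD (torusT P 0) U κ e) μ ν x)
  have h4 := MatrixNorms.opNorm_sq_le_sum_norm_sq (e (torusT P 0 μ (torusT P 0 ν x)))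
  have h2' := pow_le_pow_left₀ (norm_nonneg _) h2 2
  calc _ ≤ (N : ℝ) * ‖curl (torusT P 0) U (fun κ => covD (torusT P 0) U κ e) μ ν x‖ ^ 2 := h3
    _ ≤ N * (2 * a * ‖e (torusT P 0 μ (torusT P 0 ν x))‖) ^ 2 := by gcongr
    _ = 4 * N * a ^ 2 * ‖e (torusT P 0 μ (torusT P 0 ν x))‖ ^ 2 := by ring
    _ ≤ _ := by gcongr

omit [NeZero N] in
/-- ★ **THE COVARIANT DIRICHLET FORM AGAINST THE LAPLACIAN** (re-trace adjointness [B9] (3.8) + AM–GM): for every `s > 0`,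
`2·Σ_xΣ_μ hs(D_μe(x)) ≤ s·Σ_x hs(e x) + s⁻¹·Σ_x hs(Δ_Ue x)`, `Δ_Ue = D^*_U(D_Ue)`. [cite: Balaban1985BackgroundPropagators, (3.8) p.392] -/
theorem two_mul_dirichlet_le {U : Fin P.d → Site P 0 → (Matrix (Fin N) (Fin N) ℂ)ˣ}
    (hU : ∀ ν x, (U ν x : Matrix (Fin N) (Fin N) ℂ) ∈ unitary (Matrix (Fin N) (Fin N) ℂ))
    (e : Site P 0 → Matrix (Fin N) (Fin N) ℂ) {s : ℝ} (hs : 0 < s) :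
    2 * ∑ x : Site P 0, ∑ μ : Fin P.d, ∑ j : Fin N, ∑ k : Fin N, ‖(covD (torusT P 0) U μ e x) j k‖ ^ 2
      ≤ s * ∑ x : Site P 0, ∑ j : Fin N, ∑ k : Fin N, ‖(e x) j k‖ ^ 2
        + s⁻¹ * ∑ x : Site P 0, ∑ j : Fin N, ∑ k : Fin N, ‖(divB (torusT P 0) U (fun κ => covD (torusT P 0) U κ e) x) j k‖ ^ 2 := by
  set τ := Complex.reAddGroupHom.comp (Matrix.traceAddMonoidHom (Fin N) ℂ) with hτ
  have hτa : ∀ A : Matrix (Fin N) (Fin N) ℂ, τ A = (A.trace).re := fun A => by simp [hτ]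
  -- adjointness: `Σ_xΣ_μ Re Tr((D_μe)^* D_μe) = Σ_x Re Tr(e^* Δ_Ue)`
  have hadj := sum_sum_covD_mul (torusT P 0) U τ re_trace_mul_comm (fun z => (e z)ᴴ) (fun κ => covD (torusT P 0) U κ e)
  have hl : ∑ x : Site P 0, ∑ μ : Fin P.d, τ (covD (torusT P 0) U μ (fun z => (e z)ᴴ) x * covD (torusT P 0) U μ e x)
      = ∑ x : Site P 0, ∑ μ : Fin P.d, ∑ j : Fin N, ∑ k : Fin N, ‖(covD (torusT P 0) U μ e x) j k‖ ^ 2 := by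
    refine Finset.sum_congr rfl fun x _ => Finset.sum_congr rfl fun μ _ => ?_
    rw [← conjTranspose_covD hU, hτa, re_trace_conjTranspose_mul_self]
  rw [hl] at hadj
  rw [hadj, Finset.mul_sum, Finset.mul_sum, Finset.mul_sum, ← Finset.sum_add_distrib]
  refine Finset.sum_le_sum fun x _ => ?_
  rw [hτa]
  have h := two_mul_abs_re_trace_le hs (e x) (divB (torusT P 0) U (fun κ => covD (torusT P 0) U κ e) x)
  have habs := le_abs_self (((e x)ᴴ * divB (torusT P 0) U (fun κ => covD (torusT P 0) U κ e) x).trace).re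
  linarith

/-! ## §2 ★★★ The displayed-rows form on the torus -/

/-- ★★★ **THE CENTRE-PINNED `H²` POINCARÉ INEQUALITY FOR THE COVARIANT LAPLACIAN — DISPLAYED-ROWS FORM** (d = 3; see the module docstring).  For a unitary background with
plaquettes within `a` of `1`, a matrix field `e` vanishing on the `k`-centres, and, for every corner-cell `c₀ + ℓt + [0,ℓ]³` (`c₀ = (ℓ−1)∕2`, `ℓ = L^k`), a bi-contractive frame whose
framed links obey the four rows of ✓ `Prop7FramedHessianCell.sum_cell_hs_le_framed` (sizes `τ₁`, transverse differences `τ₂`) on the `13³`-cell Hessian window `Q_{5ℓ+1}(c₀+ℓt)`: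
`Σ_x hs(e x) ≤ κ₁ℓ⁴·[Σ_x hs(Δ_Ue x) + (2da + 8dτ₁²)·Σ_xΣ_μ hs(D_μe x) + d²(4Na² + (2τ₂+4τ₁²)²)·Σ_x hs(e x)]`, `κ₁ = 4·13³·N²·C_M`.
[cite: Giaquinta1984, Ch. III §1 Thm 1.2 pp.70–72; Balaban1985Variational, (135) p.298, Prop. 7 p.299; Balaban1985BackgroundPropagators, (3.35) p.396] -/
theorem sum_hs_le_rows (hd : P.d = 3) {k : ℕ} (hk : k ≤ P.m + P.K)
    {U : Fin P.d → Site P 0 → (Matrix (Fin N) (Fin N) ℂ)ˣ} (hU : ∀ ν x, (U ν x : Matrix (Fin N) (Fin N) ℂ) ∈ unitary (Matrix (Fin N) (Fin N) ℂ))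
    {a : ℝ} (hplaq : ∀ (μ ν : Fin P.d) (x : Site P 0), ‖(plaqU (torusT P 0) U μ ν x : Matrix (Fin N) (Fin N) ℂ) - 1‖ ≤ a)
    (e : Site P 0 → Matrix (Fin N) (Fin N) ℂ) (he0 : ∀ y : Site P k, e (embIter k y) = 0) {τ₁ τ₂ : ℝ}
    (hframes : ∀ t : Zd P.d, ∃ Fr : Site P 0 → (Matrix (Fin N) (Fin N) ℂ)ˣ,
      (∀ z : Site P 0, ‖(Fr z : Matrix (Fin N) (Fin N) ℂ)‖ ≤ 1 ∧ ‖(((Fr z)⁻¹ : (Matrix (Fin N) (Fin N) ℂ)ˣ) : Matrix (Fin N) (Fin N) ℂ)‖ ≤ 1) ∧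
      ∀ z ∈ box (fun μ : Fin P.d => (((P.L ^ k - 1) / 2 : ℕ) : ℤ) + ((P.L ^ k : ℕ) : ℤ) * t μ) (5 * ((P.L ^ k : ℕ) : ℤ) + 1), ∀ μ ν : Fin P.d,
        ‖(((Fr (fun κ => ((z κ : ℤ) : ZMod (P.sitesPerDir 0))))⁻¹ * U ν (fun κ => ((z κ : ℤ) : ZMod (P.sitesPerDir 0)))
            * Fr (torusT P 0 ν (fun κ => ((z κ : ℤ) : ZMod (P.sitesPerDir 0)))) : (Matrix (Fin N) (Fin N) ℂ)ˣ) : Matrix (Fin N) (Fin N) ℂ) - 1‖ ≤ τ₁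
        ∧ ‖(((Fr (fun κ => ((z κ : ℤ) : ZMod (P.sitesPerDir 0))))⁻¹ * U μ (fun κ => ((z κ : ℤ) : ZMod (P.sitesPerDir 0)))
            * Fr (torusT P 0 μ (fun κ => ((z κ : ℤ) : ZMod (P.sitesPerDir 0)))) : (Matrix (Fin N) (Fin N) ℂ)ˣ) : Matrix (Fin N) (Fin N) ℂ) - 1‖ ≤ τ₁
        ∧ ‖(((Fr (torusT P 0 μ (fun κ => ((z κ : ℤ) : ZMod (P.sitesPerDir 0)))))⁻¹ * U ν (torusT P 0 μ (fun κ => ((z κ : ℤ) : ZMod (P.sitesPerDir 0))))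
            * Fr (torusT P 0 ν (torusT P 0 μ (fun κ => ((z κ : ℤ) : ZMod (P.sitesPerDir 0))))) : (Matrix (Fin N) (Fin N) ℂ)ˣ) : Matrix (Fin N) (Fin N) ℂ) - 1‖ ≤ τ₁
        ∧ ‖(((Fr (torusT P 0 ν (fun κ => ((z κ : ℤ) : ZMod (P.sitesPerDir 0)))))⁻¹ * U μ (torusT P 0 ν (fun κ => ((z κ : ℤ) : ZMod (P.sitesPerDir 0))))
              * Fr (torusT P 0 μ (torusT P 0 ν (fun κ => ((z κ : ℤ) : ZMod (P.sitesPerDir 0))))) : (Matrix (Fin N) (Fin N) ℂ)ˣ) : Matrix (Fin N) (Fin N) ℂ)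
            - (((Fr (fun κ => ((z κ : ℤ) : ZMod (P.sitesPerDir 0))))⁻¹ * U μ (fun κ => ((z κ : ℤ) : ZMod (P.sitesPerDir 0)))
              * Fr (torusT P 0 μ (fun κ => ((z κ : ℤ) : ZMod (P.sitesPerDir 0)))) : (Matrix (Fin N) (Fin N) ℂ)ˣ) : Matrix (Fin N) (Fin N) ℂ)‖ ≤ τ₂) :
    ∑ x : Site P 0, ∑ j : Fin N, ∑ k' : Fin N, ‖(e x) j k'‖ ^ 2
      ≤ (4 * 2197 * (24 * 289 * 24576 * 46116) : ℝ) * (N : ℝ) ^ 2 * ((P.L : ℝ) ^ k) ^ 4 *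
          (∑ x : Site P 0, ∑ j : Fin N, ∑ k' : Fin N, ‖(divB (torusT P 0) U (fun κ => covD (torusT P 0) U κ e) x) j k'‖ ^ 2
            + (2 * P.d * a + 8 * P.d * τ₁ ^ 2) * ∑ x : Site P 0, ∑ μ : Fin P.d, ∑ j : Fin N, ∑ k' : Fin N, ‖(covD (torusT P 0) U μ e x) j k'‖ ^ 2
            + (P.d : ℝ) ^ 2 * (4 * N * a ^ 2 + (2 * τ₂ + 4 * τ₁ ^ 2) ^ 2) * ∑ x : Site P 0, ∑ j : Fin N, ∑ k' : Fin N, ‖(e x) j k'‖ ^ 2) := by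
  classical
  have hℓ1 : 1 ≤ P.L ^ k := Nat.one_le_pow k P.L P.L_pos
  have hU1 : ∀ κ y, ‖(U κ y : Matrix (Fin N) (Fin N) ℂ)‖ ≤ 1 ∧ ‖(((U κ y)⁻¹ : (Matrix (Fin N) (Fin N) ℂ)ˣ) : Matrix (Fin N) (Fin N) ℂ)‖ ≤ 1 :=
    fun κ y => mem_U1_of_unitary (hU κ y)
  -- abbreviations (local names only)
  set S : ℝ := ∑ x : Site P 0, ∑ j : Fin N, ∑ k' : Fin N, ‖(e x) j k'‖ ^ 2 with hS
  set Q : ℝ := ∑ x : Site P 0, ∑ j : Fin N, ∑ k' : Fin N, ‖(divB (torusT P 0) U (fun κ => covD (torusT P 0) U κ e) x) j k'‖ ^ 2 with hQ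
  set G : ℝ := ∑ x : Site P 0, ∑ μ : Fin P.d, ∑ j : Fin N, ∑ k' : Fin N, ‖(covD (torusT P 0) U μ e x) j k'‖ ^ 2 with hG
  set H : ℝ := ∑ x : Site P 0, ∑ μ : Fin P.d, ∑ ν : Fin P.d, ∑ j : Fin N, ∑ k' : Fin N, ‖(covD (torusT P 0) U ν (covD (torusT P 0) U μ e) x) j k'‖ ^ 2 with hH
  set Gfull : Site P 0 → ℝ := fun x => ∑ μ : Fin P.d, ∑ ν : Fin P.d,
      (∑ j : Fin N, ∑ k' : Fin N, ‖(covD (torusT P 0) U ν (covD (torusT P 0) U μ e) x) j k'‖ ^ 2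
        + 4 * τ₁ ^ 2 * ∑ j : Fin N, ∑ k' : Fin N, ‖(covD (torusT P 0) U μ e (torusT P 0 ν x)) j k'‖ ^ 2
        + 4 * τ₁ ^ 2 * ∑ j : Fin N, ∑ k' : Fin N, ‖(covD (torusT P 0) U ν e (torusT P 0 μ x)) j k'‖ ^ 2
        + (2 * τ₂ + 4 * τ₁ ^ 2) ^ 2 * ∑ j : Fin N, ∑ k' : Fin N, ‖(e (torusT P 0 μ (torusT P 0 ν x))) j k'‖ ^ 2) with hGfull
  have hGfull0 : ∀ x, 0 ≤ Gfull x := fun x => Finset.sum_nonneg fun _ _ => Finset.sum_nonneg fun _ _ => by positivity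
  -- STEP A: the torus sum is dominated by the sum over the corner-cells (per real component)
  have hA : S ≤ ∑ t ∈ (Fintype.piFinset fun _ : Fin P.d => Finset.Icc (0 : ℤ) ((P.sitesPerDir k : ℤ) - 1)),
      ∑ z ∈ (Fintype.piFinset fun i : Fin P.d =>
          Finset.Icc ((((P.L ^ k - 1) / 2 : ℕ) : ℤ) + ((P.L ^ k : ℕ) : ℤ) * t i) ((((P.L ^ k - 1) / 2 : ℕ) : ℤ) + ((P.L ^ k : ℕ) : ℤ) * t i + ((P.L ^ k : ℕ) : ℤ))),
        ∑ j : Fin N, ∑ k' : Fin N, ‖(e (fun μ => ((z μ : ℤ) : ZMod (P.sitesPerDir 0)))) j k'‖ ^ 2 := by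
    rw [hS, sum_hs_eq_components]
    have hre := fun j k' => sum_sq_le_sum_cells hk (fun x => ((e x) j k').re)
    have him := fun j k' => sum_sq_le_sum_cells hk (fun x => ((e x) j k').im)
    calc _ ≤ ∑ j : Fin N, ∑ k' : Fin N,
          (∑ t ∈ (Fintype.piFinset fun _ : Fin P.d => Finset.Icc (0 : ℤ) ((P.sitesPerDir k : ℤ) - 1)),
            ∑ z ∈ (Fintype.piFinset fun i : Fin P.d =>
                Finset.Icc ((((P.L ^ k - 1) / 2 : ℕ) : ℤ) + ((P.L ^ k : ℕ) : ℤ) * t i) ((((P.L ^ k - 1) / 2 : ℕ) : ℤ) + ((P.L ^ k : ℕ) : ℤ) * t i + ((P.L ^ k : ℕ) : ℤ))),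
              ((e (fun μ => ((z μ : ℤ) : ZMod (P.sitesPerDir 0)))) j k').re ^ 2
          + ∑ t ∈ (Fintype.piFinset fun _ : Fin P.d => Finset.Icc (0 : ℤ) ((P.sitesPerDir k : ℤ) - 1)),
            ∑ z ∈ (Fintype.piFinset fun i : Fin P.d =>
                Finset.Icc ((((P.L ^ k - 1) / 2 : ℕ) : ℤ) + ((P.L ^ k : ℕ) : ℤ) * t i) ((((P.L ^ k - 1) / 2 : ℕ) : ℤ) + ((P.L ^ k : ℕ) : ℤ) * t i + ((P.L ^ k : ℕ) : ℤ))),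
              ((e (fun μ => ((z μ : ℤ) : ZMod (P.sitesPerDir 0)))) j k').im ^ 2) :=
          Finset.sum_le_sum fun j _ => Finset.sum_le_sum fun k' _ => add_le_add (hre j k') (him j k')
      _ = _ := by
          rw [← sum_ab_comm₄]
          refine Finset.sum_congr rfl fun j _ => Finset.sum_congr rfl fun k' _ => ?_
          rw [← Finset.sum_add_distrib]
          refine Finset.sum_congr rfl fun t _ => ?_
          rw [← Finset.sum_add_distrib]
          exact Finset.sum_congr rfl fun z _ => by rw [Complex.sq_norm, Complex.normSq_apply]; ring
  -- STEP B per cell: the covariant cell inequality of FILE B1 in that cell's frame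
  have hB : ∀ t : Zd P.d,
      ∑ z ∈ (Fintype.piFinset fun i : Fin P.d =>
          Finset.Icc ((((P.L ^ k - 1) / 2 : ℕ) : ℤ) + ((P.L ^ k : ℕ) : ℤ) * t i) ((((P.L ^ k - 1) / 2 : ℕ) : ℤ) + ((P.L ^ k : ℕ) : ℤ) * t i + ((P.L ^ k : ℕ) : ℤ))),
        ∑ j : Fin N, ∑ k' : Fin N, ‖(e (fun μ => ((z μ : ℤ) : ZMod (P.sitesPerDir 0)))) j k'‖ ^ 2
      ≤ 4 * (N : ℝ) ^ 2 * (24 * 289 * 24576 * 46116 : ℝ) * ((P.L ^ k : ℕ) : ℝ) ^ 4 *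
          ∑ z ∈ box (fun μ : Fin P.d => (((P.L ^ k - 1) / 2 : ℕ) : ℤ) + ((P.L ^ k : ℕ) : ℤ) * t μ) (5 * ((P.L ^ k : ℕ) : ℤ) + 1),
            Gfull (fun κ => ((z κ : ℤ) : ZMod (P.sitesPerDir 0))) := by
    intro t
    obtain ⟨Fr, hFr, hrows⟩ := hframes t
    have hv : ∀ ε : Fin P.d → Fin 2,
        e (fun κ => ((((((P.L ^ k - 1) / 2 : ℕ) : ℤ) + ((P.L ^ k : ℕ) : ℤ) * t κ + ((P.L ^ k : ℕ) : ℤ) * ((ε κ : ℕ) : ℤ) : ℤ)) : ZMod (P.sitesPerDir 0))) = 0 := by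
      intro ε
      obtain ⟨y, hy⟩ := cast_mem_range_embIter hk
        (fun i => (((P.L ^ k - 1) / 2 : ℕ) : ℤ) + ((P.L ^ k : ℕ) : ℤ) * t i + ((P.L ^ k : ℕ) : ℤ) * ((ε i : ℕ) : ℤ))
        (fun μ => ⟨t μ + ((ε μ : ℕ) : ℤ), by push_cast; ring⟩)
      have h := he0 y
      rw [hy] at h
      exact h
    have h := sum_cell_hs_le_framed hd hU1 e (fun μ : Fin P.d => (((P.L ^ k - 1) / 2 : ℕ) : ℤ) + ((P.L ^ k : ℕ) : ℤ) * t μ) hℓ1 hv hFr hrows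
    simpa only [hGfull, Nat.cast_pow] using h
  -- STEP D: the boxes cover the torus `13^d` times
  have hD := sum_boxes_le hk Gfull hGfull0
  -- the torus sum of `Gfull`
  have hsplit : ∑ x : Site P 0, Gfull x = H + 4 * τ₁ ^ 2 * (P.d * G) + 4 * τ₁ ^ 2 * (P.d * G) + (2 * τ₂ + 4 * τ₁ ^ 2) ^ 2 * ((P.d : ℝ) ^ 2 * S) := by
    have e2 := sum_shift₂_inner (P := P) (fun μ x => ∑ j : Fin N, ∑ k' : Fin N, ‖(covD (torusT P 0) U μ e x) j k'‖ ^ 2)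
    have e3 := sum_shift₂_outer (P := P) (fun μ x => ∑ j : Fin N, ∑ k' : Fin N, ‖(covD (torusT P 0) U μ e x) j k'‖ ^ 2)
    have e4 := sum_shift_shift (P := P) (fun x => ∑ j : Fin N, ∑ k' : Fin N, ‖(e x) j k'‖ ^ 2)
    simp only [hGfull, Finset.sum_add_distrib, ← Finset.mul_sum, hH, hG, hS]
    rw [e2, e3, e4]
  -- STEP 4: the covariant Bochner step (Weitzenböck at `A := D_Ue`) and the curl of a gradient
  have hW := sum_covD_sq_le_curl_sq_add_divB_sq hU hplaq (fun κ => covD (torusT P 0) U κ e)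
  have hcurl : ∑ x : Site P 0, ∑ μ : Fin P.d, ∑ ν : Fin P.d,
        (if μ < ν then ∑ j : Fin N, ∑ k' : Fin N, ‖(curl (torusT P 0) U (fun κ => covD (torusT P 0) U κ e) μ ν x) j k'‖ ^ 2 else 0)
      ≤ 4 * N * a ^ 2 * ((P.d : ℝ) ^ 2 * S) := by
    rw [hS, ← sum_shift_shift, Finset.mul_sum]
    refine Finset.sum_le_sum fun x _ => ?_
    rw [Finset.mul_sum]
    refine Finset.sum_le_sum fun μ _ => ?_
    rw [Finset.mul_sum]
    refine Finset.sum_le_sum fun ν _ => ?_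
    have h := hs_curl_covD_le hU hplaq e μ ν x
    have h0 : 0 ≤ 4 * N * a ^ 2 * ∑ j : Fin N, ∑ k' : Fin N, ‖(e (torusT P 0 μ (torusT P 0 ν x))) j k'‖ ^ 2 := by
      have : 0 ≤ ∑ j : Fin N, ∑ k' : Fin N, ‖(e (torusT P 0 μ (torusT P 0 ν x))) j k'‖ ^ 2 :=
        Finset.sum_nonneg fun _ _ => Finset.sum_nonneg fun _ _ => sq_nonneg _
      positivity
    split_ifs
    · exact h
    · exact h0
  have hHle : H ≤ 4 * N * a ^ 2 * ((P.d : ℝ) ^ 2 * S) + Q + 2 * P.d * a * G := by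
    have hW' : H ≤ (∑ x : Site P 0, ∑ μ : Fin P.d, ∑ ν : Fin P.d,
        (if μ < ν then ∑ j : Fin N, ∑ k' : Fin N, ‖(curl (torusT P 0) U (fun κ => covD (torusT P 0) U κ e) μ ν x) j k'‖ ^ 2 else 0))
        + Q + 2 * P.d * a * G := by
      simpa only [hH, hQ, hG] using hW
    linarith [hW', hcurl]
  -- assembly
  have hκ0 : 0 ≤ 4 * (N : ℝ) ^ 2 * (24 * 289 * 24576 * 46116 : ℝ) * ((P.L ^ k : ℕ) : ℝ) ^ 4 := by positivity
  have hcast : ((P.L ^ k : ℕ) : ℝ) = (P.L : ℝ) ^ k := by push_cast; ring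
  have h3d : (13 : ℝ) ^ P.d = 2197 := by rw [hd]; norm_num
  have hd3 : (P.d : ℝ) = 3 := by rw [hd]; norm_num
  have hG0 : 0 ≤ G := Finset.sum_nonneg fun _ _ => Finset.sum_nonneg fun _ _ => Finset.sum_nonneg fun _ _ => Finset.sum_nonneg fun _ _ => sq_nonneg _
  have hS0 : 0 ≤ S := Finset.sum_nonneg fun _ _ => Finset.sum_nonneg fun _ _ => Finset.sum_nonneg fun _ _ => sq_nonneg _
  have hτ : 0 ≤ τ₁ ^ 2 := sq_nonneg _
  have ha2 : 0 ≤ a ^ 2 := sq_nonneg _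
  have hmain : S ≤ 4 * (N : ℝ) ^ 2 * (24 * 289 * 24576 * 46116 : ℝ) * ((P.L ^ k : ℕ) : ℝ) ^ 4 * ((13 : ℝ) ^ P.d * ∑ x : Site P 0, Gfull x) := by
    calc S ≤ _ := hA
      _ ≤ ∑ t ∈ (Fintype.piFinset fun _ : Fin P.d => Finset.Icc (0 : ℤ) ((P.sitesPerDir k : ℤ) - 1)),
            4 * (N : ℝ) ^ 2 * (24 * 289 * 24576 * 46116 : ℝ) * ((P.L ^ k : ℕ) : ℝ) ^ 4 *
              ∑ z ∈ box (fun μ : Fin P.d => (((P.L ^ k - 1) / 2 : ℕ) : ℤ) + ((P.L ^ k : ℕ) : ℤ) * t μ) (5 * ((P.L ^ k : ℕ) : ℤ) + 1),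
                Gfull (fun κ => ((z κ : ℤ) : ZMod (P.sitesPerDir 0))) := Finset.sum_le_sum fun t _ => hB t
      _ = 4 * (N : ℝ) ^ 2 * (24 * 289 * 24576 * 46116 : ℝ) * ((P.L ^ k : ℕ) : ℝ) ^ 4 *
            ∑ t ∈ (Fintype.piFinset fun _ : Fin P.d => Finset.Icc (0 : ℤ) ((P.sitesPerDir k : ℤ) - 1)),
              ∑ z ∈ box (fun μ : Fin P.d => (((P.L ^ k - 1) / 2 : ℕ) : ℤ) + ((P.L ^ k : ℕ) : ℤ) * t μ) (5 * ((P.L ^ k : ℕ) : ℤ) + 1),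
                Gfull (fun κ => ((z κ : ℤ) : ZMod (P.sitesPerDir 0))) := by rw [Finset.mul_sum]
      _ ≤ _ := mul_le_mul_of_nonneg_left hD hκ0
  rw [hsplit, h3d, hcast] at hmain
  rw [hd3] at hmain ⊢
  have hX : 0 ≤ 4 * (N : ℝ) ^ 2 * (24 * 289 * 24576 * 46116 : ℝ) * ((P.L : ℝ) ^ k) ^ 4 * 2197 := by positivity
  have hHle' := mul_le_mul_of_nonneg_left hHle hX
  rw [hd3] at hHle'
  linarith [hmain, hHle']

/-! ## §3 ★★★ The absorbed form -/

set_option maxHeartbeats 400000 in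
/-- ★★★ **THE CENTRE-PINNED `H²` POINCARÉ INEQUALITY FOR THE COVARIANT LAPLACIAN — ABSORBED** (d = 3): under the window `κ₁ℓ⁴·d²(4Na² + (2τ₂+4τ₁²)²) ≤ 1∕4`
(`κ₁ = 4·13³·N²·C_M`; at the member `a = e_aℓ⁻²`, `τ₁ = C₀e∕ℓ`, `τ₂ = C₁e∕ℓ²` it is the ℓ-FREE smallness `κ₁d²(4Ne_a² + (2C₁e + 4C₀²e²)²) ≤ 1∕4`),
`Σ_x hs(e x) ≤ 2(κ₁ℓ⁴ + (κ₁ℓ⁴(2da + 8dτ₁²))²)·Σ_x hs(Δ_Ue x)` — at the member `(κ₁ℓ⁴(2da + 8dτ₁²))² = κ₁²ℓ⁴(2de_a + 8dC₀²e²)²`, so every `ℓ` sits in the `ℓ⁴` prefactor exactly as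
in the flat ✓ `sum_sq_le_laplace_sq_of_vanish_centres`.  Proof: §2 + ✓ `two_mul_dirichlet_le` at `s = 1∕(2B)`, `B = κ₁ℓ⁴(2da + 8dτ₁²)`.
[cite: Giaquinta1984, Ch. III §1 Thm 1.2 pp.70–72; Balaban1985Variational, Prop. 7 p.299; Balaban1985BackgroundPropagators, Thm 3.11 p.416] -/
theorem sum_hs_le_covLaplace_hs (hd : P.d = 3) {k : ℕ} (hk : k ≤ P.m + P.K)
    {U : Fin P.d → Site P 0 → (Matrix (Fin N) (Fin N) ℂ)ˣ} (hU : ∀ ν x, (U ν x : Matrix (Fin N) (Fin N) ℂ) ∈ unitary (Matrix (Fin N) (Fin N) ℂ))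
    {a : ℝ} (hplaq : ∀ (μ ν : Fin P.d) (x : Site P 0), ‖(plaqU (torusT P 0) U μ ν x : Matrix (Fin N) (Fin N) ℂ) - 1‖ ≤ a)
    (e : Site P 0 → Matrix (Fin N) (Fin N) ℂ) (he0 : ∀ y : Site P k, e (embIter k y) = 0) {τ₁ τ₂ : ℝ}
    (hframes : ∀ t : Zd P.d, ∃ Fr : Site P 0 → (Matrix (Fin N) (Fin N) ℂ)ˣ,
      (∀ z : Site P 0, ‖(Fr z : Matrix (Fin N) (Fin N) ℂ)‖ ≤ 1 ∧ ‖(((Fr z)⁻¹ : (Matrix (Fin N) (Fin N) ℂ)ˣ) : Matrix (Fin N) (Fin N) ℂ)‖ ≤ 1) ∧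
      ∀ z ∈ box (fun μ : Fin P.d => (((P.L ^ k - 1) / 2 : ℕ) : ℤ) + ((P.L ^ k : ℕ) : ℤ) * t μ) (5 * ((P.L ^ k : ℕ) : ℤ) + 1), ∀ μ ν : Fin P.d,
        ‖(((Fr (fun κ => ((z κ : ℤ) : ZMod (P.sitesPerDir 0))))⁻¹ * U ν (fun κ => ((z κ : ℤ) : ZMod (P.sitesPerDir 0)))
            * Fr (torusT P 0 ν (fun κ => ((z κ : ℤ) : ZMod (P.sitesPerDir 0)))) : (Matrix (Fin N) (Fin N) ℂ)ˣ) : Matrix (Fin N) (Fin N) ℂ) - 1‖ ≤ τ₁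
        ∧ ‖(((Fr (fun κ => ((z κ : ℤ) : ZMod (P.sitesPerDir 0))))⁻¹ * U μ (fun κ => ((z κ : ℤ) : ZMod (P.sitesPerDir 0)))
            * Fr (torusT P 0 μ (fun κ => ((z κ : ℤ) : ZMod (P.sitesPerDir 0)))) : (Matrix (Fin N) (Fin N) ℂ)ˣ) : Matrix (Fin N) (Fin N) ℂ) - 1‖ ≤ τ₁
        ∧ ‖(((Fr (torusT P 0 μ (fun κ => ((z κ : ℤ) : ZMod (P.sitesPerDir 0)))))⁻¹ * U ν (torusT P 0 μ (fun κ => ((z κ : ℤ) : ZMod (P.sitesPerDir 0))))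
            * Fr (torusT P 0 ν (torusT P 0 μ (fun κ => ((z κ : ℤ) : ZMod (P.sitesPerDir 0))))) : (Matrix (Fin N) (Fin N) ℂ)ˣ) : Matrix (Fin N) (Fin N) ℂ) - 1‖ ≤ τ₁
        ∧ ‖(((Fr (torusT P 0 ν (fun κ => ((z κ : ℤ) : ZMod (P.sitesPerDir 0)))))⁻¹ * U μ (torusT P 0 ν (fun κ => ((z κ : ℤ) : ZMod (P.sitesPerDir 0))))
              * Fr (torusT P 0 μ (torusT P 0 ν (fun κ => ((z κ : ℤ) : ZMod (P.sitesPerDir 0))))) : (Matrix (Fin N) (Fin N) ℂ)ˣ) : Matrix (Fin N) (Fin N) ℂ)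
            - (((Fr (fun κ => ((z κ : ℤ) : ZMod (P.sitesPerDir 0))))⁻¹ * U μ (fun κ => ((z κ : ℤ) : ZMod (P.sitesPerDir 0)))
              * Fr (torusT P 0 μ (fun κ => ((z κ : ℤ) : ZMod (P.sitesPerDir 0)))) : (Matrix (Fin N) (Fin N) ℂ)ˣ) : Matrix (Fin N) (Fin N) ℂ)‖ ≤ τ₂)
    (hwin : (4 * 2197 * (24 * 289 * 24576 * 46116) : ℝ) * (N : ℝ) ^ 2 * ((P.L : ℝ) ^ k) ^ 4
        * ((P.d : ℝ) ^ 2 * (4 * N * a ^ 2 + (2 * τ₂ + 4 * τ₁ ^ 2) ^ 2)) ≤ 1 / 4) :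
    ∑ x : Site P 0, ∑ j : Fin N, ∑ k' : Fin N, ‖(e x) j k'‖ ^ 2
      ≤ 2 * ((4 * 2197 * (24 * 289 * 24576 * 46116) : ℝ) * (N : ℝ) ^ 2 * ((P.L : ℝ) ^ k) ^ 4
          + ((4 * 2197 * (24 * 289 * 24576 * 46116) : ℝ) * (N : ℝ) ^ 2 * ((P.L : ℝ) ^ k) ^ 4 * (2 * P.d * a + 8 * P.d * τ₁ ^ 2)) ^ 2)
        * ∑ x : Site P 0, ∑ j : Fin N, ∑ k' : Fin N, ‖(divB (torusT P 0) U (fun κ => covD (torusT P 0) U κ e) x) j k'‖ ^ 2 := by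
  have h := sum_hs_le_rows hd hk hU hplaq e he0 hframes
  set S : ℝ := ∑ x : Site P 0, ∑ j : Fin N, ∑ k' : Fin N, ‖(e x) j k'‖ ^ 2 with hS
  set Q : ℝ := ∑ x : Site P 0, ∑ j : Fin N, ∑ k' : Fin N, ‖(divB (torusT P 0) U (fun κ => covD (torusT P 0) U κ e) x) j k'‖ ^ 2 with hQ
  set G : ℝ := ∑ x : Site P 0, ∑ μ : Fin P.d, ∑ j : Fin N, ∑ k' : Fin N, ‖(covD (torusT P 0) U μ e x) j k'‖ ^ 2 with hG
  set κ : ℝ := (4 * 2197 * (24 * 289 * 24576 * 46116) : ℝ) * (N : ℝ) ^ 2 * ((P.L : ℝ) ^ k) ^ 4 with hκ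
  have hS0 : 0 ≤ S := Finset.sum_nonneg fun _ _ => Finset.sum_nonneg fun _ _ => Finset.sum_nonneg fun _ _ => sq_nonneg _
  have hQ0 : 0 ≤ Q := Finset.sum_nonneg fun _ _ => Finset.sum_nonneg fun _ _ => Finset.sum_nonneg fun _ _ => sq_nonneg _
  have hG0 : 0 ≤ G := Finset.sum_nonneg fun _ _ => Finset.sum_nonneg fun _ _ => Finset.sum_nonneg fun _ _ => Finset.sum_nonneg fun _ _ => sq_nonneg _
  have hκ0 : 0 ≤ κ := by positivity
  have ha : 0 ≤ a := (norm_nonneg _).trans (hplaq ⟨0, by rw [hd]; norm_num⟩ ⟨0, by rw [hd]; norm_num⟩ fun _ => 0)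
  have hB0 : 0 ≤ κ * (2 * P.d * a + 8 * P.d * τ₁ ^ 2) := by positivity
  -- the `S`-term of §2 is at most `S∕4`
  have hΓ : κ * ((P.d : ℝ) ^ 2 * (4 * N * a ^ 2 + (2 * τ₂ + 4 * τ₁ ^ 2) ^ 2)) * S ≤ 1 / 4 * S := mul_le_mul_of_nonneg_right hwin hS0
  -- the `G`-term is at most `S∕4 + B²Q`
  have hBG : κ * (2 * P.d * a + 8 * P.d * τ₁ ^ 2) * G ≤ 1 / 4 * S + (κ * (2 * P.d * a + 8 * P.d * τ₁ ^ 2)) ^ 2 * Q := by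
    rcases hB0.eq_or_lt with hB | hB
    · rw [← hB]; nlinarith [hS0, hQ0]
    · have hs : 0 < 1 / (2 * (κ * (2 * P.d * a + 8 * P.d * τ₁ ^ 2))) := by positivity
      have hd2 := two_mul_dirichlet_le hU e hs
      have e1 : (1 / (2 * (κ * (2 * P.d * a + 8 * P.d * τ₁ ^ 2))))⁻¹ = 2 * (κ * (2 * P.d * a + 8 * P.d * τ₁ ^ 2)) := by
        rw [one_div, inv_inv]
      rw [e1] at hd2
      have h3 := mul_le_mul_of_nonneg_left hd2 (half_pos hB).le
      have e2 : κ * (2 * P.d * a + 8 * P.d * τ₁ ^ 2) / 2 * (2 * G) = κ * (2 * P.d * a + 8 * P.d * τ₁ ^ 2) * G := by ring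
      have key : ∀ B S' Q' : ℝ, B ≠ 0 → B / 2 * (1 / (2 * B) * S' + 2 * B * Q') = 1 / 4 * S' + B ^ 2 * Q' := by
        intro B S' Q' hBne
        field_simp
        ring
      have e3 : κ * (2 * P.d * a + 8 * P.d * τ₁ ^ 2) / 2 *
          (1 / (2 * (κ * (2 * P.d * a + 8 * P.d * τ₁ ^ 2))) * S + 2 * (κ * (2 * P.d * a + 8 * P.d * τ₁ ^ 2)) * Q)
          = 1 / 4 * S + (κ * (2 * P.d * a + 8 * P.d * τ₁ ^ 2)) ^ 2 * Q := key _ S Q hB.ne' 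
      rw [e2, e3] at h3
      exact h3
  have h' : S ≤ κ * (Q + (2 * P.d * a + 8 * P.d * τ₁ ^ 2) * G + (P.d : ℝ) ^ 2 * (4 * N * a ^ 2 + (2 * τ₂ + 4 * τ₁ ^ 2) ^ 2) * S) := h
  have e4 : κ * (Q + (2 * P.d * a + 8 * P.d * τ₁ ^ 2) * G + (P.d : ℝ) ^ 2 * (4 * N * a ^ 2 + (2 * τ₂ + 4 * τ₁ ^ 2) ^ 2) * S)
      = κ * Q + κ * (2 * P.d * a + 8 * P.d * τ₁ ^ 2) * G + κ * ((P.d : ℝ) ^ 2 * (4 * N * a ^ 2 + (2 * τ₂ + 4 * τ₁ ^ 2) ^ 2)) * S := by ring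
  rw [e4] at h'
  nlinarith [h', hΓ, hBG, hS0, hQ0, hκ0]

end Summit.QuantumFields.YangMills.Theorems.Prop7CentrePinnedHessianPoincareCov

end
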